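import Summits.QuantumFields.BalabanUV.Beta.GAN24.MonotoneTorusPlaquette
import Literature.MathematicalPhysics.QuantumFieldTheory.King1986.TorusBlockForm

/-!
# Beta / GAN24 / MonotoneTorusHodge — THE DISCRETE POINCARÉ LEMMA ON THE TORUS (curl-free 1-forms are gradients plus constants, by the
# finite Fourier transform) and its consequence for road P4's torus avatar: under UNIT-BLOCK constraints every TRANSVERSE test form is a
# legitimate read source, so the canonical read-outs of the block-constrained covariance through ANY transverse test-form matrix are
# Loewner-antitone under refinement — finding (N1) of the gen-2 diagnostic in its own currency, as a theorem on tori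
# (gan24-p4 gen 3; SKELETON-P4 §8 optional re-indexing «plaquette family → all transverse t»; BINDER-OWNERS row G-an2-4 ∕ (CONV-C), ALTERNATIVE
# DISCHARGE «rate OR monotonicity»; NOT IN PRINT — our proof attempt)

HONEST FRAMING (page 1 of everything the β sub-cell writes): discharging `BetaPertH` makes Bałaban's UV stability UNCONDITIONAL — a
real constructive-QFT result; it is NOT the continuum limit and NOT the Clay problem.  HONEST DEPENDENCY (cell reorg 2026-08-19, verbatim):
«continuum YM on T⁴ ⇐ BetaPertH ∧ nine spine estimates (0/9 proved); BetaPertH ⇐ (D1) ∧ (D4) ∧ CAP+tail; G-an2-4 gates asym, D1 and NE2/3/4.»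
HONEST LABEL: «not in print; our proof attempt; alternative discharge of the G-an2-4 row (rate OR monotonicity)»; 0 wall binders instantiated.
ABSOLUTE RULE honoured: nothing cited.  Tree theorems consumed BY NAME: the torus characters of `B5Prop11Plancherel` (`chi`, `sum_chi`, `chi_unitVec`,
`chi_add_right/left`), Mathlib's `ZMod.injective_stdAddChar`, Bałaban's (1.20) `B5Block118.QvOp_gaugeT_eq` («Q_kA^λ = Q_kA − ∂Q′_kλ», kernel-proved there),
and `GAN24/MonotoneTorus{Tower,Plaquette}`, `GAN24/MonotoneCritical`.  [folklore] throughout.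

## WHAT IS PROVED
* §1 (any torus `Tor N`) `fcoef` (Fourier coefficients of a 1-form), `sum_conj_chi_shift`, `fcoef_plaq` (curl-free ⟹ `(χ_μ−1)ĉ_ν = (χ_ν−1)ĉ_μ`),
  `exists_omega_ne_zero` (`p ≠ 0 ⟹ some χ_μ(p) ≠ 1`), `sum_chi_mul_fcoef` (Fourier inversion), and **`exists_potential_of_plaq_eq_zero`**:
  `plaq z ≡ 0 ⟹ ∃ λ h, z(x,μ) = λ(x+e_μ) − λ(x) + h μ` — THE DISCRETE POINCARÉ LEMMA (closed = exact ⊕ harmonic, harmonic 1-forms on the torus = constants).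
* §2 (B5 averages) `QvOp_mulVec_const` (a true average fixes constants), `QvOp_mulVec_gradOp` ((1.20) BY NAME: `Q_n(∂λ) = ∂(Q′_nλ)`), `sum_gradOp_eq_zero`.
* §3 **`transverse_source_legit`**: read-out torus `fine Lc M₀`, UNIT-BLOCK rows `R = QvOp Lc M₀`; a test form `t` with `(GradOp _ 1)ᴴ t = 0` (transverse ∕ co-closed) is orthogonal
  to `sread j z` for every level-`j` field `z` with `rows R j z = 0` and `hform j z = 0` — the legitimacy hypothesis of `MonotoneTorusTower.readOut_chain_torus` ∕
  `MonotoneCritical.isCrit_critCov` DISCHARGED for transverse test forms.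
* §4 **`transverse_readOut_antitone`**: for every test-form matrix `T` with transverse rows (`T * GradOp _ 1 = 0`) the canonical read-outs
  `(T * sread j) critCov (hform j) (rows R j) (T * sread j)ᴴ` satisfy `(P j − P (j+1)).PosSemidef` for all `j`; `transverse_readOut_entry_dev_le` ((MONO-K)₂ from one datum).
SCOPE (honest): torus avatar, abelian∕linearised layer, unit-block constraints exactly (`R = QvOp Lc M₀`); NOT an2's ℤ^{d+1} system; NOT BetaPertH, NOT continuum, NOT Clay.
-/

noncomputable section

namespace Summit.QuantumFields.BalabanUV.Beta.GAN24.MonotoneTorusHodge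

open Matrix Finset
open scoped BigOperators ComplexOrder ComplexConjugate
open Literature.MathematicalPhysics.QuantumFieldTheory.Balaban1983to89
open Literature.MathematicalPhysics.QuantumFieldTheory.Balaban1983to89.B5Prop11Plancherel (Tor fine unitVec chi chi_add_left chi_add_right
  chi_zero_left conj_chi chi_neg_neg chi_unitVec sum_chi)
open Literature.MathematicalPhysics.QuantumFieldTheory.Balaban1983to89.B5Action121 (GradOp GradOp_mulVec sdiff_mulVec gaugeT)
open Literature.MathematicalPhysics.QuantumFieldTheory.Balaban1983to89.B5Block118 (QvOp QsOp QvOp_mulVec lineSum QvOp_gaugeT_eq)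
open Literature.MathematicalPhysics.QuantumFieldTheory.Balaban1983to89.B5AverageCurlStokes (plaq plaq_apply)
open Summit.QuantumFields.BalabanUV.Beta.GAN24.MonotoneCoarsen (IsCrit conj_pairing)
open Summit.QuantumFields.BalabanUV.Beta.GAN24.MonotoneCritical (critCov critCov_conjTranspose isCrit_critCov)
open Summit.QuantumFields.BalabanUV.Beta.GAN24.MonotoneTorusTower (Lev sread cstep rows hform hform_isHermitian hform_posSemidef
  readOut_chain_torus readOut_entry_dev_le_torus)
open Summit.QuantumFields.BalabanUV.Beta.GAN24.MonotoneTorusPlaquette (plaq_eq_zero_of_hform_mulVec)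
open Summit.QuantumFields.BalabanUV.Beta.CapRowsTail (MonotoneTailDown)
open Literature.MathematicalPhysics.QuantumFieldTheory.King1986.Torus (chi_comm)

variable {d : ℕ}

/-! ## §1 The discrete Poincaré lemma on the torus `Π_μ ℤ/N_μ` -/

section Hodge

variable (N : Fin d → ℕ) [hN : ∀ μ, NeZero (N μ)]

/-- Fourier coefficient of the `μ`-component of a 1-form: `ĉ_μ(p) = Σ_x conj(e^{ip·x}) z(x,μ)`. [folklore] -/
def fcoef (z : Tor N × Fin d → ℂ) (μ : Fin d) (p : Tor N) : ℂ := ∑ x : Tor N, conj (chi N p x) * z (x, μ)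

/-- `conj e^{ip·(−x)} = e^{ip·x}`. [folklore] -/
theorem conj_chi_neg (p x : Tor N) : conj (chi N p (-x)) = chi N p x := by
  rw [conj_chi, chi_neg_neg]

/-- `e^{ip·e} · conj e^{ip·e} = 1`. [folklore] -/
theorem chi_mul_conj (p e : Tor N) : chi N p e * conj (chi N p e) = 1 := by
  rw [conj_chi, ← chi_add_left, add_neg_cancel, chi_zero_left]

/-- SHIFT RULE: `Σ_x conj(e^{ip·x}) z(x + e, ν) = e^{ip·e} · ĉ_ν(p)`. [folklore] -/
theorem sum_conj_chi_shift (z : Tor N × Fin d → ℂ) (ν : Fin d) (p e : Tor N) :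
    ∑ x : Tor N, conj (chi N p x) * z (x + e, ν) = chi N p e * fcoef N z ν p := by
  unfold fcoef
  rw [← Equiv.sum_comp (Equiv.addRight e) (fun x => conj (chi N p x) * z (x, ν)), Finset.mul_sum]
  refine Finset.sum_congr rfl fun x _ => ?_
  simp only [Equiv.coe_addRight]
  rw [chi_add_right, map_mul]
  linear_combination (-(conj (chi N p x) * z (x + e, ν))) * chi_mul_conj N p e

/-- **CURL-FREE IN FOURIER**: `plaq z ≡ 0 ⟹ (χ_μ(p) − 1) ĉ_ν(p) = (χ_ν(p) − 1) ĉ_μ(p)`, `χ_μ(p) = e^{ip·e_μ}`. [folklore] -/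
theorem fcoef_plaq (z : Tor N × Fin d → ℂ) (hz : ∀ μ ν x, plaq N z μ ν x = 0) (p : Tor N) (μ ν : Fin d) :
    (chi N p (unitVec N μ) - 1) * fcoef N z ν p = (chi N p (unitVec N ν) - 1) * fcoef N z μ p := by
  have h0 : ∑ x : Tor N, conj (chi N p x) * plaq N z μ ν x = 0 := by
    simp only [hz, mul_zero, Finset.sum_const_zero]
  simp only [plaq_apply, mul_add, mul_sub, Finset.sum_add_distrib, Finset.sum_sub_distrib, sum_conj_chi_shift] at h0
  have e1 : ∑ x : Tor N, conj (chi N p x) * z (x, μ) = fcoef N z μ p := rfl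
  have e2 : ∑ x : Tor N, conj (chi N p x) * z (x, ν) = fcoef N z ν p := rfl
  rw [e1, e2] at h0
  linear_combination h0

/-- A nonzero torus momentum has a direction with `χ_μ(p) ≠ 1` (the standard character of `ℤ/N` is injective). [folklore] -/
theorem exists_omega_ne_zero {p : Tor N} (hp : p ≠ 0) : ∃ μ, chi N p (unitVec N μ) - 1 ≠ 0 := by
  obtain ⟨μ, hμ⟩ : ∃ μ, p μ ≠ 0 := Function.ne_iff.mp hp
  refine ⟨μ, fun h => hμ ?_⟩
  rw [sub_eq_zero, chi_unitVec] at h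
  exact ZMod.injective_stdAddChar (N := N μ) (h.trans (AddChar.map_zero_eq_one _).symm)

/-- FOURIER INVERSION for the coefficients: `Σ_p e^{ip·x} ĉ_μ(p) = |T| · z(x,μ)`. [folklore] -/
theorem sum_chi_mul_fcoef (z : Tor N × Fin d → ℂ) (μ : Fin d) (x : Tor N) :
    ∑ p : Tor N, chi N p x * fcoef N z μ p = (Fintype.card (Tor N) : ℂ) * z (x, μ) := by
  classical
  unfold fcoef
  simp_rw [Finset.mul_sum, ← mul_assoc]
  rw [Finset.sum_comm]
  have key : ∀ y : Tor N, ∑ p : Tor N, chi N p x * conj (chi N p y) * z (y, μ)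
      = (if y = x then (Fintype.card (Tor N) : ℂ) else 0) * z (y, μ) := by
    intro y
    rw [← Finset.sum_mul]
    congr 1
    have h1 : ∀ p : Tor N, chi N p x * conj (chi N p y) = chi N (x - y) p := by
      intro p
      rw [← neg_neg y, conj_chi_neg, neg_neg, ← chi_add_right, ← sub_eq_add_neg, chi_comm N]
    simp_rw [h1]
    rw [sum_chi]
    simp only [sub_eq_zero, eq_comm]
  simp_rw [key]
  simp only [ite_mul, zero_mul, Finset.sum_ite_eq', Finset.mem_univ, if_true]

/-- **THE DISCRETE POINCARÉ LEMMA ON THE TORUS.**  A 1-form `z` on `Π_μ ℤ/N_μ` all of whose plaquette variables vanish is a gradient plus a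
constant 1-form: `z(x,μ) = λ(x + e_μ) − λ(x) + h_μ` (the harmonic 1-forms of the torus are the constants).  Proof: Fourier — at `p ≠ 0` some
`χ_μ(p) ≠ 1` and `ĉ_ν(p) = (χ_ν(p) − 1)·λ̂(p)`; at `p = 0` the coefficient is the constant part. [folklore] -/
theorem exists_potential_of_plaq_eq_zero (z : Tor N × Fin d → ℂ) (hz : ∀ μ ν x, plaq N z μ ν x = 0) :
    ∃ (lam : Tor N → ℂ) (h : Fin d → ℂ), ∀ x μ, z (x, μ) = lam (x + unitVec N μ) - lam x + h μ := by
  classical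
  have hω : ∀ p : Tor N, p ≠ 0 → ∃ μ, chi N p (unitVec N μ) - 1 ≠ 0 := fun p hp => exists_omega_ne_zero N hp
  let lamHat : Tor N → ℂ := fun p =>
    if hp : p = 0 then 0 else fcoef N z (Classical.choose (hω p hp)) p / (chi N p (unitVec N (Classical.choose (hω p hp))) - 1)
  -- every coefficient is `(χ_μ − 1)·λ̂` plus the zero-momentum part
  have hc : ∀ (p : Tor N) (μ : Fin d),
      fcoef N z μ p = (chi N p (unitVec N μ) - 1) * lamHat p + (if p = 0 then fcoef N z μ 0 else 0) := by
    intro p μ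
    by_cases hp : p = 0
    · subst hp
      simp [lamHat, chi_zero_left]
    · have hspec : chi N p (unitVec N (Classical.choose (hω p hp))) - 1 ≠ 0 := Classical.choose_spec (hω p hp)
      simp only [lamHat, dif_neg hp, if_neg hp, add_zero]
      have hrel := fcoef_plaq N z hz p (Classical.choose (hω p hp)) μ
      field_simp
      linear_combination hrel
  have hcard : (Fintype.card (Tor N) : ℂ) ≠ 0 := Nat.cast_ne_zero.mpr Fintype.card_ne_zero
  refine ⟨fun x => (∑ p : Tor N, chi N p x * lamHat p) / Fintype.card (Tor N), fun μ => fcoef N z μ 0 / Fintype.card (Tor N),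
    fun x μ => ?_⟩
  have hinv0 := sum_chi_mul_fcoef N z μ x
  have hinv : ∑ p : Tor N, chi N p x * ((chi N p (unitVec N μ) - 1) * lamHat p + (if p = 0 then fcoef N z μ 0 else 0))
      = (Fintype.card (Tor N) : ℂ) * z (x, μ) := by
    rw [← hinv0]
    exact Finset.sum_congr rfl fun p _ => by rw [← hc p μ]
  simp_rw [mul_add, Finset.sum_add_distrib] at hinv
  have e1 : ∑ p : Tor N, chi N p x * ((chi N p (unitVec N μ) - 1) * lamHat p)
      = ∑ p : Tor N, chi N p (x + unitVec N μ) * lamHat p - ∑ p : Tor N, chi N p x * lamHat p := by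
    rw [← Finset.sum_sub_distrib]
    refine Finset.sum_congr rfl fun p _ => ?_
    rw [chi_add_right]; ring
  have e2 : ∑ p : Tor N, chi N p x * (if p = 0 then fcoef N z μ 0 else 0) = fcoef N z μ 0 := by
    simp only [mul_ite, mul_zero, Finset.sum_ite_eq', Finset.mem_univ, if_true, chi_zero_left, one_mul]
  rw [e1, e2] at hinv
  rw [← sub_div, ← add_div, eq_div_iff hcard]
  linear_combination (-1 : ℂ) * hinv

end Hodge

/-! ## §2 Bałaban's averages on constants and gradients ((1.20) BY NAME) -/

section Averages

variable (n : ℕ) [NeZero n] (M : Fin d → ℕ) [hM : ∀ μ, NeZero (M μ)]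

/-- A TRUE AVERAGE FIXES THE CONSTANT 1-FORMS: `Q_n (h) = h`. [folklore] -/
theorem QvOp_mulVec_const (h : Fin d → ℂ) :
    QvOp n M *ᵥ (fun b : Tor (fine n M) × Fin d => h b.2) = fun b : Tor M × Fin d => h b.2 := by
  funext b
  obtain ⟨y, μ⟩ := b
  rw [QvOp_mulVec]
  simp only [lineSum, Finset.sum_const, Finset.card_univ, Fintype.card_fin, Fintype.card_fun, nsmul_eq_mul]
  have hn : (n : ℂ) ≠ 0 := by exact_mod_cast NeZero.ne n
  push_cast
  field_simp
  ring

/-- (1.20) ON GRADIENTS: `Q_n (∂λ) = ∂ (Q′_n λ′)` with `λ′ = λ/n` (the tree's `B5Block118.QvOp_gaugeT_eq` BY NAME; unit gradient on both lattices). [folklore] -/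
theorem QvOp_mulVec_gradOp (lam : Tor (fine n M) → ℂ) :
    QvOp n M *ᵥ (GradOp (fine n M) 1 *ᵥ lam) = GradOp M 1 *ᵥ (QsOp n M *ᵥ ((1 / (n : ℂ)) • lam)) := by
  have hn : (n : ℂ) ≠ 0 := by exact_mod_cast NeZero.ne n
  have hg : GradOp (fine n M) 1 *ᵥ lam = GradOp (fine n M) (n : ℂ) *ᵥ ((1 / (n : ℂ)) • lam) := by
    funext b
    obtain ⟨x, ν⟩ := b
    rw [GradOp_mulVec, GradOp_mulVec, sdiff_mulVec, sdiff_mulVec]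
    simp only [Pi.smul_apply, smul_eq_mul]
    field_simp
  have h := QvOp_gaugeT_eq n M (0 : Tor (fine n M) × Fin d → ℂ) ((1 / (n : ℂ)) • lam)
  rw [gaugeT, zero_sub, mulVec_neg, mulVec_zero, zero_sub, neg_inj] at h
  rw [hg, h]

omit [NeZero n] in
/-- The components of a gradient sum to zero over the torus: `Σ_y (∂f)(y, μ) = 0`. [folklore] -/
theorem sum_gradOp_eq_zero (f : Tor M → ℂ) (μ : Fin d) : ∑ y : Tor M, (GradOp M 1 *ᵥ f) (y, μ) = 0 := by
  simp only [GradOp_mulVec, sdiff_mulVec, one_mul, Finset.sum_sub_distrib]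
  have h : ∑ x : Tor M, f (x + unitVec M μ) = ∑ x : Tor M, f x := Fintype.sum_equiv (Equiv.addRight (unitVec M μ)) _ _ (fun _ => rfl)
  rw [h, sub_self]

end Averages

/-! ## §3 Transverse test forms are legitimate under unit-block constraints -/

section Legit

variable (Lc : ℕ) [NeZero Lc] (M₀ : Fin d → ℕ) [hM₀ : ∀ μ, NeZero (M₀ μ)]

/-- **TRANSVERSE TEST FORMS ARE LEGITIMATE READ SOURCES.**  Read-out torus `fine Lc M₀` (the `Lc⁻¹`-sub-blocks of the unit torus `Tor M₀`), unit-block rows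
`R = QvOp Lc M₀`; a test form `t` on the read-out 1-forms with `(GradOp _ 1)ᴴ t = 0` (co-closed).  Then for every level `j` and every fine field `z` with
`rows R j z = 0` and `hform j z = 0`: `⟨z, (sread j)ᴴ t⟩ = 0`.  Route: `z` is curl-free (`plaq_eq_zero_of_hform_mulVec`) ⟹ `z = ∂λ + h` (§1) ⟹ `sread j z = ∂(Q′λ′) + h`
((1.20), `QvOp_mulVec_const`) and the unit-block rows force `h = 0` (`sum_gradOp_eq_zero`) ⟹ `⟨sread j z, t⟩ = ⟨Q′λ′, ∂ᴴ t⟩ = 0`. [folklore] -/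
theorem transverse_source_legit (t : Tor (fine Lc M₀) × Fin d → ℂ) (ht : (GradOp (fine Lc M₀) 1)ᴴ *ᵥ t = 0) (j : ℕ)
    (z : Lev Lc (fine Lc M₀) j → ℂ) (hR : rows Lc (fine Lc M₀) (QvOp Lc M₀) j *ᵥ z = 0) (hH : hform Lc (fine Lc M₀) j *ᵥ z = 0) :
    star z ⬝ᵥ ((sread Lc (fine Lc M₀) j)ᴴ *ᵥ t) = 0 := by
  classical
  -- `z` is curl-free, hence a gradient plus a constant
  have hz := plaq_eq_zero_of_hform_mulVec Lc (fine Lc M₀) j z hH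
  obtain ⟨lam, h, hdec⟩ := exists_potential_of_plaq_eq_zero (fine (Lc ^ j) (fine Lc M₀)) z hz
  have hzeq : z = GradOp (fine (Lc ^ j) (fine Lc M₀)) 1 *ᵥ lam + fun b => h b.2 := by
    funext b
    obtain ⟨x, μ⟩ := b
    rw [Pi.add_apply, GradOp_mulVec, sdiff_mulVec, one_mul, hdec]
  -- its sub-block averages: `sread j z = ∂κ + h`
  set κ : Tor (fine Lc M₀) → ℂ := QsOp (Lc ^ j) (fine Lc M₀) *ᵥ ((1 / ((Lc ^ j : ℕ) : ℂ)) • lam) with hκ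
  have hsz : sread Lc (fine Lc M₀) j *ᵥ z = GradOp (fine Lc M₀) 1 *ᵥ κ + fun b => h b.2 := by
    unfold sread
    rw [hzeq, mulVec_add, QvOp_mulVec_gradOp, QvOp_mulVec_const]
  -- the unit-block rows: `Q_{Lc} (∂κ + h) = ∂(Q′κ′) + h = 0` ⟹ `h = 0`
  have hrow : QvOp Lc M₀ *ᵥ (GradOp (fine Lc M₀) 1 *ᵥ κ + fun b => h b.2) = 0 := by
    rw [← hsz]
    unfold rows at hR
    rwa [← mulVec_mulVec] at hR
  rw [mulVec_add, QvOp_mulVec_gradOp, QvOp_mulVec_const] at hrow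
  have hh : ∀ μ, h μ = 0 := by
    intro μ
    have hs := congrArg (fun w : Tor M₀ × Fin d → ℂ => ∑ y : Tor M₀, w (y, μ)) hrow
    simp only [Pi.add_apply, Pi.zero_apply, Finset.sum_add_distrib, sum_gradOp_eq_zero, zero_add, Finset.sum_const,
      Finset.card_univ, nsmul_eq_mul, mul_zero] at hs
    have hc : (Fintype.card (Tor M₀) : ℂ) ≠ 0 := Nat.cast_ne_zero.mpr Fintype.card_ne_zero
    exact (mul_eq_zero.mp hs).resolve_left hc
  have hconst : (fun b : Tor (fine Lc M₀) × Fin d => h b.2) = 0 := by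
    funext b; exact hh b.2
  -- `⟨z, Sᴴ t⟩ = ⟨S z, t⟩ = ⟨∂κ, t⟩ = ⟨κ, ∂ᴴ t⟩ = 0`
  rw [← conj_pairing, hsz, hconst, add_zero, conj_pairing, ht, dotProduct_zero]

end Legit

/-! ## §4 The canonical read-outs through transverse test forms are antitone under refinement -/

section Chain

variable (Lc : ℕ) [NeZero Lc] (M₀ : Fin d → ℕ) [hM₀ : ∀ μ, NeZero (M₀ μ)]
variable {l : Type*} [Fintype l]

/-- **FINDING (N1) AS A THEOREM ON TORI.**  Unit torus `Tor M₀`, averaging factor `Lc ≥ 1`, read-out lattice `fine Lc M₀` (the `Lc⁻¹`-sub-blocks), unit-block constraints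
`R = QvOp Lc M₀`, and ANY test-form matrix `T` with TRANSVERSE rows (`T * GradOp _ 1 = 0`).  Then the canonical read-outs
`P j := (T * sread j) · critCov (hform j) (rows R j) · (T * sread j)ᴴ` of the block-constrained level-`j` covariance satisfy `(P j − P (j+1)).PosSemidef` for
every `j` — Loewner-antitone under refinement, NO rate, NO constant, NO gauge fixing, no hypothesis beyond transversality. [folklore] -/
theorem transverse_readOut_antitone (T : Matrix l (Tor (fine Lc M₀) × Fin d) ℂ) (hT : T * GradOp (fine Lc M₀) 1 = 0) (j : ℕ) :
    ((T * sread Lc (fine Lc M₀) j) * critCov (hform_isHermitian Lc (fine Lc M₀) j) (rows Lc (fine Lc M₀) (QvOp Lc M₀) j)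
        * (T * sread Lc (fine Lc M₀) j)ᴴ
      - (T * sread Lc (fine Lc M₀) (j + 1)) * critCov (hform_isHermitian Lc (fine Lc M₀) (j + 1)) (rows Lc (fine Lc M₀) (QvOp Lc M₀) (j + 1))
        * (T * sread Lc (fine Lc M₀) (j + 1))ᴴ).PosSemidef := by
  have hTt : ∀ u : l → ℂ, (GradOp (fine Lc M₀) 1)ᴴ *ᵥ (Tᴴ *ᵥ u) = 0 := by
    intro u
    rw [mulVec_mulVec, ← conjTranspose_mul, hT, conjTranspose_zero, zero_mulVec]
  refine readOut_chain_torus Lc (fine Lc M₀) T (QvOp Lc M₀)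
    (fun j => critCov (hform_isHermitian Lc (fine Lc M₀) j) (rows Lc (fine Lc M₀) (QvOp Lc M₀) j)) (fun _ => critCov_conjTranspose _ _)
    (fun j u => isCrit_critCov (hform_posSemidef Lc (fine Lc M₀) j) _ fun z hzR hzH => ?_) j
  rw [conjTranspose_mul, ← mulVec_mulVec]
  exact transverse_source_legit Lc M₀ (Tᴴ *ᵥ u) (hTt u) j z hzR hzH

/-- **(MONO-K)₂ FOR TRANSVERSE READ-OUTS FROM ONE TRACE DATUM — NO RATE** (`readOut_entry_dev_le_torus` with the legitimacy of §3). [folklore] -/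
theorem transverse_readOut_entry_dev_le (T : Matrix l (Tor (fine Lc M₀) × Fin d) ℂ) (hT : T * GradOp (fine Lc M₀) 1 = 0) {k₀ : ℕ} {η₀ : ℝ}
    (hdat : ∀ j, k₀ ≤ j →
      ((T * sread Lc (fine Lc M₀) k₀) * critCov (hform_isHermitian Lc (fine Lc M₀) k₀) (rows Lc (fine Lc M₀) (QvOp Lc M₀) k₀)
          * (T * sread Lc (fine Lc M₀) k₀)ᴴ
        - (T * sread Lc (fine Lc M₀) j) * critCov (hform_isHermitian Lc (fine Lc M₀) j) (rows Lc (fine Lc M₀) (QvOp Lc M₀) j)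
          * (T * sread Lc (fine Lc M₀) j)ᴴ).trace.re ≤ η₀) :
    (∀ j j', k₀ ≤ j → k₀ ≤ j' → ∀ a b,
      ‖((T * sread Lc (fine Lc M₀) j) * critCov (hform_isHermitian Lc (fine Lc M₀) j) (rows Lc (fine Lc M₀) (QvOp Lc M₀) j)
            * (T * sread Lc (fine Lc M₀) j)ᴴ
          - (T * sread Lc (fine Lc M₀) j') * critCov (hform_isHermitian Lc (fine Lc M₀) j') (rows Lc (fine Lc M₀) (QvOp Lc M₀) j')
            * (T * sread Lc (fine Lc M₀) j')ᴴ) a b‖ ≤ η₀) ∧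
      MonotoneTailDown (fun j => ((T * sread Lc (fine Lc M₀) j) * critCov (hform_isHermitian Lc (fine Lc M₀) j)
        (rows Lc (fine Lc M₀) (QvOp Lc M₀) j) * (T * sread Lc (fine Lc M₀) j)ᴴ).trace.re) k₀ := by
  have hTt : ∀ u : l → ℂ, (GradOp (fine Lc M₀) 1)ᴴ *ᵥ (Tᴴ *ᵥ u) = 0 := by
    intro u
    rw [mulVec_mulVec, ← conjTranspose_mul, hT, conjTranspose_zero, zero_mulVec]
  refine readOut_entry_dev_le_torus Lc (fine Lc M₀) T (QvOp Lc M₀)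
    (fun j => critCov (hform_isHermitian Lc (fine Lc M₀) j) (rows Lc (fine Lc M₀) (QvOp Lc M₀) j)) (fun _ => critCov_conjTranspose _ _)
    (fun j u => isCrit_critCov (hform_posSemidef Lc (fine Lc M₀) j) _ fun z hzR hzH => ?_) hdat
  rw [conjTranspose_mul, ← mulVec_mulVec]
  exact transverse_source_legit Lc M₀ (Tᴴ *ᵥ u) (hTt u) j z hzR hzH

end Chain

end Summit.QuantumFields.BalabanUV.Beta.GAN24.MonotoneTorusHodge

end
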